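import Literature.Probability.Percolation.OneArmScalingLimitAvoidance
import HarnessLib

/-!
# LSW's scaling limit of the clusters meeting the circle ⇔ convergence of connection probabilities

Topic `Literature/Probability/Percolation`, companion to `OneArmScalingLimit.lean`,
`OneArmScalingLimitProofs.lean` and `OneArmScalingLimitAvoidance.lean` (proofs only: no
definitions, no named facts). The existence of LSW's scaling limit
(Lawler–Schramm–Werner, Electron. J. Probab. 7 (2002), §2, p. 3: "the law of `Q_δ(θ)` can be
thought of as a probability measure on the Hausdorff space of compact subsets of `Ū`. By
[22, 23], the limit exists") is the weak convergence, as `R → ∞`, of the laws `lswLaw R` of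
LSW's random compact sets `Q_{1/R} = lswCompact R` (the unit circle together with the rescaled
open clusters of the disc of radius `R` joined to its outside), in Lean the statement
`∃ ν : ProbabilityMeasure (NonemptyCompacts ℂ), Tendsto lswLaw atTop (𝓝 ν)` (formerly the named
fact `LawlerSchrammWerner2002_scalingLimit`, merged back into an explicit hypothesis on the D-0026
review of 2026-08-15: the one-arm cone needs only subsequential limits; the theorem names below are
kept). `OneArmScalingLimitProofs.lean`
reduced it to the uniqueness of subsequential weak limits (tightness is free). Here the
hyperspace measure theory is removed altogether: by the uniqueness theorem for laws of random
compact sets (`Literature.MeasureTheory.RandomSets.probabilityMeasure_eq_of_isTopologicalBasis`: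
a Borel probability measure on `NonemptyCompacts ℂ` is determined by its avoidance functional on
finite unions of sets of a countable basis; Molchanov 2005, Chap. 1, §1.6 and App. C, Thm. C.5)
and the portmanteau theorem at continuity sets (Billingsley 1999, Thm. 2.1), the statement is
**equivalent** to a statement about critical site percolation on `𝕋` alone:

* `LawlerSchrammWerner2002_scalingLimit_iff_tendsto_connection` — the limit exists iff there are a
  dense set `D ⊆ ℂ` of centres and a countable exceptional set `N ⊆ ℝ` of radii such that for
  every finite union `U = ⋃ᵢ B(zᵢ, rᵢ) ⊆ 𝕌` of open discs with `zᵢ ∈ D`, `0 < rᵢ ∉ N`, the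
  connection probabilities `P_{1/2}[∃ x y, x/R ∈ U, ‖y‖ > R, x ↔ y open]` ("`R·U` is joined to
  the outside of the disc of radius `R`"; the complement of LSW's avoidance event
  `{Q_{1/R} ∩ U = ∅}`, `lswLaw_setOf_disjoint_eq`) converge as `R → ∞`.

The forward direction (`tendsto_connection_of_scalingLimit`) is the portmanteau theorem: for
each centre all but countably many radii give continuity sets of the limit law. The backward
direction (`subseqLimit_eq_of_tendsto_connection`,
`LawlerSchrammWerner2002_scalingLimit_of_tendsto_connection`) identifies any two subsequential
limits `ν, ν'` through their avoidance functionals on a countable basis of discs whose radii are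
continuity radii of both (`exists_isTopologicalBasis_ball`). An exceptional set of radii cannot be
dispensed with in the forward direction without further percolation input (it is empty in the
literature by the "no-touching" arm estimates), which is why the equivalence is stated with it.
The convergence of these connection probabilities is what Smirnov's theorem / the Camia–Newman
full scaling limit provide (LSW's references [22, 23]; Camia–Newman, Comm. Math. Phys. 268
(2006), Thm. 1 with §6); it is not proved here.

## References

* G. F. Lawler, O. Schramm, W. Werner, *One-arm exponent for critical 2D percolation*, Electron.
  J. Probab. 7 (2002), no. 2, §2 (p. 3) [LawlerSchrammWernerEJP2002].
* I. Molchanov, *Theory of Random Sets*, Springer (2005), Chap. 1, §1.6; App. C, Thm. C.5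
  [Molchanov2005].
* P. Billingsley, *Convergence of probability measures*, 2nd ed. (1999), Thms. 2.1, 2.6
  [Billingsley1999].
* F. Camia, C. M. Newman, *Two-dimensional critical percolation: the full scaling limit*, Comm.
  Math. Phys. 268 (2006), Thm. 1, §6 [CamiaNewman2006].
-/

noncomputable section

open MeasureTheory Filter Topology Metric TopologicalSpace Set
open Literature.MeasureTheory.RandomSets Literature.Probability.LatticeModels
open scoped ENNReal NNReal

namespace Literature.Probability.Percolation

/-! ### The scaling limit from convergence of connection probabilities -/

/-- **Identification of subsequential limits through connection probabilities.** Let `D ⊆ ℂ`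
be dense and `N ⊆ ℝ` countable, and assume that for every finite family of discs with
`⋃ᵢ B(zᵢ, rᵢ) ⊆ 𝕌`, `zᵢ ∈ D`, `0 < rᵢ ∉ N`, the connection probabilities
`P_{1/2}[∃ x y, x/R ∈ ⋃ᵢ B(zᵢ, rᵢ), ‖y‖ > R, x ↔ y]` converge as `R → ∞`. Then any two weak
limits `ν, ν'` of `lswLaw` along sequences `R_k, R'_k → ∞` coincide. Proof: choose a
countable basis of discs with centres in `D` or on `∂𝕌`, radii off `N` and off the (countably
many) discontinuity radii of `ν` and `ν'` (`exists_isTopologicalBasis_ball`); for a finite union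
`U` of such discs the avoidance event is a continuity set of both limits, so by the portmanteau
theorem `ν{K ∩ U = ∅}` and `ν'{K ∩ U = ∅}` are both the limit of `P[Q_{1/R} ∩ U = ∅]`, which
exists: it is `0` if a disc is centred on `∂𝕌 ⊆ Q_{1/R}`, and otherwise one minus the connection
probability of the discs inside `𝕌` (those outside `Ū ⊇ Q_{1/R}` are irrelevant); conclude by the
uniqueness theorem for avoidance functionals (`probabilityMeasure_eq_of_isTopologicalBasis`).
[cite: Molchanov2005, Chap. 1, §1.6 and App. C, Thm. C.5] [cite: Billingsley1999, Thm 2.1] -/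
theorem subseqLimit_eq_of_tendsto_connection {D : Set ℂ} (hD : Dense D) {N : Set ℝ}
    (hN : N.Countable)
    (H : ∀ F : Finset (ℂ × ℝ), (∀ p ∈ F, p.1 ∈ D ∧ 0 < p.2 ∧ p.2 ∉ N) →
      (⋃ p ∈ F, ball p.1 p.2) ⊆ ball (0 : ℂ) 1 →
        ∃ c : ℝ, Tendsto (fun R : ℝ => (triSitePercolation half).real
          {ω | ∃ x y : Site 2, (triMeshPoint R⁻¹ x ∈ ⋃ p ∈ F, ball p.1 p.2) ∧
            R < ‖triEmbed y‖ ∧ PathIn triGraph ω x y}) atTop (𝓝 c))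
    {R R' : ℕ → ℝ} {ν ν' : ProbabilityMeasure (NonemptyCompacts ℂ)}
    (hR : Tendsto R atTop atTop) (hν : Tendsto (lswLaw ∘ R) atTop (𝓝 ν))
    (hR' : Tendsto R' atTop atTop) (hν' : Tendsto (lswLaw ∘ R') atTop (𝓝 ν')) : ν = ν' := by
  classical
  -- forbidden radii: `N` and the discontinuity radii of `ν` and `ν'`
  let bad : ℂ → Set ℝ := fun z => N ∪
    ({r | 0 < (ν : Measure (NonemptyCompacts ℂ)) {K | infDist z (K : Set ℂ) = r}} ∪
      {r | 0 < (ν' : Measure (NonemptyCompacts ℂ)) {K | infDist z (K : Set ℂ) = r}})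
  have hbad : ∀ z, (bad z).Countable := fun z =>
    hN.union ((countable_setOf_measure_infDist_eq_pos _ z).union
      (countable_setOf_measure_infDist_eq_pos _ z))
  obtain ⟨b, hbc, hb, hshape⟩ := exists_isTopologicalBasis_ball hD bad hbad
  choose! zc rad hpos hnotbad hVeq hkind using hshape
  refine probabilityMeasure_eq_of_isTopologicalBasis hb hbc fun F hF => ?_
  -- the finite union of basic discs, re-indexed by (centre, radius)
  set G : Finset (ℂ × ℝ) := F.image fun V => (zc V, rad V) with hG
  have hUeq : (⋃ V ∈ F, V) = ⋃ p ∈ G, ball p.1 p.2 := by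
    rw [hG, Finset.set_biUnion_finset_image]
    refine iUnion₂_congr fun V hV => ?_
    exact hVeq V (hF hV)
  set E : Set (NonemptyCompacts ℂ) := {K | Disjoint (K : Set ℂ) (⋃ p ∈ G, ball p.1 p.2)} with hE
  have hEeq : {K : NonemptyCompacts ℂ | Disjoint (K : Set ℂ) (⋃ V ∈ F, V)} = E := by
    rw [hE, hUeq]
  rw [hEeq]
  -- `E` is a continuity set of `ν` and of `ν'`
  have hGmem : ∀ p ∈ G, ∃ V ∈ F, p = (zc V, rad V) := by
    intro p hp
    rw [hG, Finset.mem_image] at hp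
    obtain ⟨V, hV, rfl⟩ := hp
    exact ⟨V, hV, rfl⟩
  have hnull : ∀ μ : ProbabilityMeasure (NonemptyCompacts ℂ), (∀ p ∈ G,
      (μ : Measure (NonemptyCompacts ℂ)) {K | infDist p.1 (K : Set ℂ) = p.2} = 0) →
      μ (frontier E) = 0 := by
    intro μ hμ
    rw [ProbabilityMeasure.null_iff_toMeasure_null]
    exact measure_frontier_setOf_disjoint_biUnion_ball_eq_zero _ G hμ
  have hν0 : ν (frontier E) = 0 := by
    refine hnull ν fun p hp => ?_
    obtain ⟨V, hV, rfl⟩ := hGmem p hp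
    have h := hnotbad V (hF hV)
    simp only [bad, mem_union, mem_setOf_eq, not_or, not_lt, nonpos_iff_eq_zero] at h
    exact h.2.1
  have hν'0 : ν' (frontier E) = 0 := by
    refine hnull ν' fun p hp => ?_
    obtain ⟨V, hV, rfl⟩ := hGmem p hp
    have h := hnotbad V (hF hV)
    simp only [bad, mem_union, mem_setOf_eq, not_or, not_lt, nonpos_iff_eq_zero] at h
    exact h.2.2
  have hmE : MeasurableSet E := measurableSet_setOf_disjoint_biUnion_ball G
  -- portmanteau along the two subsequences
  have hT : Tendsto (fun k => lswLaw (R k) E) atTop (𝓝 (ν E)) :=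
    ProbabilityMeasure.tendsto_measure_of_null_frontier_of_tendsto hν hν0
  have hT' : Tendsto (fun k => lswLaw (R' k) E) atTop (𝓝 (ν' E)) :=
    ProbabilityMeasure.tendsto_measure_of_null_frontier_of_tendsto hν' hν'0
  -- the avoidance probabilities `R ↦ P[Q_{1/R} ∈ E]` converge as `R → ∞`
  have hlim : ∃ a : ℝ≥0, Tendsto (fun R : ℝ => lswLaw R E) atTop (𝓝 a) := by
    by_cases hcirc : ∃ p ∈ G, ‖p.1‖ = 1
    · -- a disc centred on the circle: the event is impossible for every `R`
      obtain ⟨p, hp, hp1⟩ := hcirc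
      refine ⟨0, tendsto_const_nhds.congr' (Eventually.of_forall fun R => ?_)⟩
      obtain ⟨V, hV, rfl⟩ := hGmem p hp
      have hzV : zc V ∈ ⋃ p ∈ G, ball p.1 p.2 := by
        refine mem_biUnion hp ?_
        exact mem_ball_self (hpos V (hF hV))
      have hempty : lswCompact R ⁻¹' E = ∅ := by
        ext ω
        simp only [mem_preimage, mem_empty_iff_false, iff_false]
        exact lswCompact_not_mem_setOf_disjoint_of_mem_sphere hzV hp1 ω
      symm
      rw [ProbabilityMeasure.null_iff_toMeasure_null, lswLaw_apply R hmE, hempty, measure_empty]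
    · -- no disc centred on the circle: split into discs inside `𝕌` and discs outside `Ū`
      push Not at hcirc
      set G₁ : Finset (ℂ × ℝ) := G.filter fun p => p.2 ≤ 1 - ‖p.1‖ with hG₁
      set G₃ : Finset (ℂ × ℝ) := G.filter fun p => ¬ p.2 ≤ 1 - ‖p.1‖ with hG₃
      have hkind' : ∀ p ∈ G, (p.1 ∈ D ∧ p.2 ≤ 1 - ‖p.1‖) ∨ p.2 ≤ ‖p.1‖ - 1 := by
        intro p hp
        obtain ⟨V, hV, rfl⟩ := hGmem p hp
        rcases hkind V (hF hV) with h | h | h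
        · exact Or.inl h
        · exact absurd h (hcirc _ hp)
        · exact Or.inr h
      have hU₁ : (⋃ p ∈ G₁, ball p.1 p.2) ⊆ ball (0 : ℂ) 1 := by
        refine iUnion₂_subset fun p hp => ?_
        rw [hG₁, Finset.mem_filter] at hp
        exact ball_subset_ball_zero_one hp.2
      have hW : Disjoint (⋃ p ∈ G₃, ball p.1 p.2) (closedBall (0 : ℂ) 1) := by
        rw [disjoint_iUnion₂_left]
        intro p hp
        rw [hG₃, Finset.mem_filter] at hp
        rcases hkind' p hp.1 with h | h
        · exact absurd h.2 hp.2
        · exact disjoint_ball_closedBall_zero_one h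
      have hsplit : (⋃ p ∈ G, ball p.1 p.2) =
          (⋃ p ∈ G₁, ball p.1 p.2) ∪ ⋃ p ∈ G₃, ball p.1 p.2 := by
        rw [hG₁, hG₃, ← Finset.set_biUnion_union, Finset.filter_union_filter_not_eq]
      have hG₁hyp : ∀ p ∈ G₁, p.1 ∈ D ∧ 0 < p.2 ∧ p.2 ∉ N := by
        intro p hp
        rw [hG₁, Finset.mem_filter] at hp
        obtain ⟨V, hV, rfl⟩ := hGmem p hp.1
        refine ⟨?_, hpos V (hF hV), fun hn => hnotbad V (hF hV) (Or.inl hn)⟩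
        rcases hkind' _ hp.1 with h | h
        · exact h.1
        · exfalso
          have := hpos V (hF hV)
          have h2 := hp.2
          simp only at h h2 this
          linarith [norm_nonneg (zc V)]
      obtain ⟨c, hc⟩ := H G₁ hG₁hyp hU₁
      refine ⟨(1 - c).toNNReal, ?_⟩
      have hreal : Tendsto (fun R : ℝ => ((lswLaw R E : ℝ≥0) : ℝ)) atTop (𝓝 (1 - c)) := by
        refine (tendsto_const_nhds.sub hc).congr' ?_
        filter_upwards [eventually_gt_atTop 0] with R hR
        have hEev : lswCompact R ⁻¹' E =
            lswCompact R ⁻¹' {K | Disjoint (K : Set ℂ) (⋃ p ∈ G₁, ball p.1 p.2)} := by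
          ext ω
          simp only [mem_preimage, hE, hsplit]
          exact lswCompact_mem_setOf_disjoint_union_iff hW ω
        have hm₁ : MeasurableSet {K : NonemptyCompacts ℂ |
            Disjoint (K : Set ℂ) (⋃ p ∈ G₁, ball p.1 p.2)} :=
          measurableSet_setOf_disjoint_biUnion_ball G₁
        have hEq : lswLaw R E = lswLaw R {K | Disjoint (K : Set ℂ) (⋃ p ∈ G₁, ball p.1 p.2)} := by
          apply ENNReal.coe_injective
          rw [ProbabilityMeasure.ennreal_coeFn_eq_coeFn_toMeasure,
            ProbabilityMeasure.ennreal_coeFn_eq_coeFn_toMeasure, lswLaw_apply R hmE,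
            lswLaw_apply R hm₁, hEev]
        rw [hEq, lswLaw_setOf_disjoint_eq hR (isOpen_biUnion_ball G₁) hU₁]
      refine (tendsto_real_toNNReal hreal).congr fun R => ?_
      simp
  obtain ⟨a, ha⟩ := hlim
  have h1 : ν E = a := tendsto_nhds_unique hT (ha.comp hR)
  have h2 : ν' E = a := tendsto_nhds_unique hT' (ha.comp hR')
  rw [← ProbabilityMeasure.ennreal_coeFn_eq_coeFn_toMeasure,
    ← ProbabilityMeasure.ennreal_coeFn_eq_coeFn_toMeasure, h1, h2]

/-- **LSW's scaling limit from convergence of connection probabilities.** If there are a dense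
set `D ⊆ ℂ` and a countable `N ⊆ ℝ` such that for every finite union `U = ⋃ᵢ B(zᵢ, rᵢ) ⊆ 𝕌` of
open discs with `zᵢ ∈ D`, `0 < rᵢ ∉ N`, the probabilities
`P_{1/2}[∃ x y, x/R ∈ U, ‖y‖ > R, x ↔ y open in 𝕋]` converge as `R → ∞`, then the laws of LSW's
`Q_{1/R}` converge weakly on the Hausdorff space (LSW's "the limit exists", §2, p. 3;
with `LawlerSchrammWerner2002_scalingLimit_of_subseqLimit_unique`: tightness, Prokhorov,
uniqueness of subsequential limits). The hypothesis is the content of Smirnov's theorem / the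
Camia–Newman full scaling limit as LSW use it (LSW 2002, §2, p. 3, refs. [22, 23]; Camia–Newman
2006, Thm. 1 and §6), not proved here. [cite: LawlerSchrammWernerEJP2002, §2 (p. 3)]
[cite: Molchanov2005, Chap. 1, §1.6 and App. C, Thm. C.5] [cite: Billingsley1999, Thm 2.1 and Thm 2.6] -/
theorem LawlerSchrammWerner2002_scalingLimit_of_tendsto_connection {D : Set ℂ} (hD : Dense D)
    {N : Set ℝ} (hN : N.Countable)
    (H : ∀ F : Finset (ℂ × ℝ), (∀ p ∈ F, p.1 ∈ D ∧ 0 < p.2 ∧ p.2 ∉ N) →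
      (⋃ p ∈ F, ball p.1 p.2) ⊆ ball (0 : ℂ) 1 →
        ∃ c : ℝ, Tendsto (fun R : ℝ => (triSitePercolation half).real
          {ω | ∃ x y : Site 2, (triMeshPoint R⁻¹ x ∈ ⋃ p ∈ F, ball p.1 p.2) ∧
            R < ‖triEmbed y‖ ∧ PathIn triGraph ω x y}) atTop (𝓝 c)) :
    ∃ ν : ProbabilityMeasure (NonemptyCompacts ℂ), Tendsto lswLaw atTop (𝓝 ν) :=
  LawlerSchrammWerner2002_scalingLimit_of_subseqLimit_unique
    fun _ _ _ _ hR hν hR' hν' => subseqLimit_eq_of_tendsto_connection hD hN H hR hν hR' hν'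

/-! ### Conversely: the scaling limit gives convergence of connection probabilities -/

/-- **The scaling limit gives convergence of the connection probabilities** at all discs with
centres in any countable set `D` and radii off a countable exceptional set (the discontinuity
radii of the limit law at the centres of `D`): for such finite unions `U ⊆ 𝕌` the avoidance event
`{K ∩ U = ∅}` is a continuity set of the limit `ν`, so `P[Q_{1/R} ∩ U = ∅] → ν{K ∩ U = ∅}` by the
portmanteau theorem, and the connection probability is its complement
(`lswLaw_setOf_disjoint_eq`). [cite: Billingsley1999, Thm 2.1] [cite: LawlerSchrammWernerEJP2002, §2 (p. 3)] -/
theorem tendsto_connection_of_scalingLimit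
    (h : ∃ ν : ProbabilityMeasure (NonemptyCompacts ℂ), Tendsto lswLaw atTop (𝓝 ν))
    {D : Set ℂ} (hDc : D.Countable) :
    ∃ N : Set ℝ, N.Countable ∧
      ∀ F : Finset (ℂ × ℝ), (∀ p ∈ F, p.1 ∈ D ∧ 0 < p.2 ∧ p.2 ∉ N) →
        (⋃ p ∈ F, ball p.1 p.2) ⊆ ball (0 : ℂ) 1 →
          ∃ c : ℝ, Tendsto (fun R : ℝ => (triSitePercolation half).real
            {ω | ∃ x y : Site 2, (triMeshPoint R⁻¹ x ∈ ⋃ p ∈ F, ball p.1 p.2) ∧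
              R < ‖triEmbed y‖ ∧ PathIn triGraph ω x y}) atTop (𝓝 c) := by
  obtain ⟨ν, hν⟩ := h
  refine ⟨⋃ z ∈ D, {r | 0 < (ν : Measure (NonemptyCompacts ℂ)) {K | infDist z (K : Set ℂ) = r}},
    hDc.biUnion fun z _ => countable_setOf_measure_infDist_eq_pos _ z, fun F hF hU => ?_⟩
  set E : Set (NonemptyCompacts ℂ) := {K | Disjoint (K : Set ℂ) (⋃ p ∈ F, ball p.1 p.2)} with hE
  have hν0 : ν (frontier E) = 0 := by
    rw [ProbabilityMeasure.null_iff_toMeasure_null]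
    refine measure_frontier_setOf_disjoint_biUnion_ball_eq_zero _ F fun p hp => ?_
    obtain ⟨hpD, -, hpN⟩ := hF p hp
    simp only [mem_iUnion, mem_setOf_eq, not_exists, exists_prop, not_and, not_lt,
      nonpos_iff_eq_zero] at hpN
    exact hpN p.1 hpD
  have hT : Tendsto (fun R : ℝ => lswLaw R E) atTop (𝓝 (ν E)) :=
    ProbabilityMeasure.tendsto_measure_of_null_frontier_of_tendsto hν hν0
  have hT' : Tendsto (fun R : ℝ => ((lswLaw R E : ℝ≥0) : ℝ)) atTop (𝓝 ((ν E : ℝ≥0) : ℝ)) :=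
    (NNReal.continuous_coe.tendsto _).comp hT
  refine ⟨1 - ((ν E : ℝ≥0) : ℝ), ?_⟩
  have h2 : Tendsto (fun R : ℝ => 1 - ((lswLaw R E : ℝ≥0) : ℝ)) atTop
      (𝓝 (1 - ((ν E : ℝ≥0) : ℝ))) := tendsto_const_nhds.sub hT'
  refine h2.congr' ?_
  filter_upwards [eventually_gt_atTop 0] with R hR
  rw [hE, lswLaw_setOf_disjoint_eq hR (isOpen_biUnion_ball F) hU]
  ring

/-- **Existence of LSW's scaling limit ⇔ convergence of connection probabilities.** The
laws of LSW's `Q_{1/R}` converge weakly on the Hausdorff space of compact subsets of the plane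
(LSW 2002, §2, p. 3) if and only if there are a dense set `D ⊆ ℂ` of centres and a countable
exceptional set `N ⊆ ℝ` of radii such that for every finite union `U = ⋃ᵢ B(zᵢ, rᵢ) ⊆ 𝕌` of open
discs with `zᵢ ∈ D` and `0 < rᵢ ∉ N` the probability that `R·U` is joined by an open path of
critical site percolation on `𝕋` to the outside of the disc of radius `R` converges as `R → ∞`.
This isolates exactly the percolation content of LSW's "By [22, 23], the limit exists" (Smirnov
2001; Camia–Newman 2006, Thm. 1): everything about the Hausdorff space, tightness and the
identification of limit laws is proved. [cite: LawlerSchrammWernerEJP2002, §2 (p. 3)]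
[cite: Molchanov2005, Chap. 1, §1.6 and App. C, Thm. C.5] [cite: Billingsley1999, Thm 2.1 and Thm 2.6] -/
theorem LawlerSchrammWerner2002_scalingLimit_iff_tendsto_connection :
    (∃ ν : ProbabilityMeasure (NonemptyCompacts ℂ), Tendsto lswLaw atTop (𝓝 ν)) ↔
      ∃ D : Set ℂ, Dense D ∧ ∃ N : Set ℝ, N.Countable ∧
        ∀ F : Finset (ℂ × ℝ), (∀ p ∈ F, p.1 ∈ D ∧ 0 < p.2 ∧ p.2 ∉ N) →
          (⋃ p ∈ F, ball p.1 p.2) ⊆ ball (0 : ℂ) 1 →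
            ∃ c : ℝ, Tendsto (fun R : ℝ => (triSitePercolation half).real
              {ω | ∃ x y : Site 2, (triMeshPoint R⁻¹ x ∈ ⋃ p ∈ F, ball p.1 p.2) ∧
                R < ‖triEmbed y‖ ∧ PathIn triGraph ω x y}) atTop (𝓝 c) := by
  constructor
  · intro h
    obtain ⟨D, hDc, hDd⟩ := TopologicalSpace.exists_countable_dense ℂ
    obtain ⟨N, hN, hconv⟩ := tendsto_connection_of_scalingLimit h hDc
    exact ⟨D, hDd, N, hN, hconv⟩
  · rintro ⟨D, hD, N, hN, H⟩
    exact LawlerSchrammWerner2002_scalingLimit_of_tendsto_connection hD hN H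

end Literature.Probability.Percolation
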